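import Summits.Ventures.PercRepro.ProfileGapMonoThresholdTopNuTwoCount

/-!
# PercRepro — THE TWO COUNTS AT THE TOP THRESHOLD OF THE CO-RANK-`q` FAMILY ON A MATROID WITH A RANK-`(q−1)` FLAT
OF `ν + q − 2` POINTS, UNIFORMLY IN `q` (p5, gen 30; `proofs/P5-GM1.md` §41(h); announced INBOX 13953)

The `q = 4` counts of ProfileGapMonoThresholdTopNuTwoCount with `3, 4, 2` replaced by `q − 1, q, q − 2`: for `F = cl B`
a rank-`(q−1)` flat with `ν + q − 2` points on a coloop-free matroid of rank `R ≥ q` (`2 ≤ q`), `O = E ∖ F` its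
series-class complement (`s = #O`, `s + (q − 2) = R`), **`card_top_demanding'`** — the rank-`(q−1)` sets with
complement rank exactly `R` number `A + s · Bℓ` (`A = #{D ⊆ F : ρ(D) = q − 1, ρ(O ∪ (F ∖ D)) = R}`,
`Bℓ = #{D ⊆ F : ρ(D) = q − 2, ρ(F ∖ D) = q − 1}`), and **`card_top_targets'`** — the rank-`q` sets with complement
rank `≥ R − 1` number `s · A₂ + C(s,2) · (Bℓ, or C₂ when s = 2)` (`A₂ = #{ρ(D) = q − 1, ρ(F ∖ D) ≥ q − 2}`,
`C₂ = #{ρ(O ∪ D) = q, ρ(F ∖ D) = q − 1}`).  The counting is the same three-case analysis (`Y = ∅`, `∅ ≠ Y ⊊ O`,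
`Y = O`) on the `(Y, D)`-split.  Nothing open is asserted.
-/

open scoped Matroid

namespace PercRepro.Cogirth

open Finset ThmH Skew Shadow Profile

variable {α : Type} [DecidableEq α] {N : Matroid α} [N.Finite]

section TopLongFlatCount

variable {q : ℕ}

omit [DecidableEq α] in
/-- `ρ(D) ≤ q − 1` for a subset `D` of a rank-`(q−1)` flat `cl B`. -/
theorem rk_le_of_subset_clF' {B : Finset α} (hB : B ∈ Rq N (q - 1)) {D : Finset α} (hD : D ⊆ clF N B) :
    rk N D ≤ q - 1 := by
  have hBrk : rk N B = q - 1 := rk_eq_of_eRk_eq_cq (mem_Rq.1 hB).2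
  have := rk_mono' (M := N) hD
  rw [rk_clF, hBrk] at this
  exact this

/-- **The three cases of the rank of `Y ∪ D`** at co-rank `q` (`2 ≤ q`): for `∅ ≠ Y ⊊ O = E ∖ cl B`, `D ⊆ cl B`. -/
theorem rk_union_cases' (hq : 2 ≤ q) (hcf : ∀ z ∈ gr N, rk N ((gr N).erase z) = rk N (gr N)) {B : Finset α}
    (hB : B ∈ Rq N (q - 1)) (hlong : (clF N B).card + rk N (gr N) = (gr N).card + (q - 2))
    {Y D : Finset α} (hY : Y ⊆ gr N \ clF N B) (hD : D ⊆ clF N B) (hYne : Y.Nonempty)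
    (hYO : Y ≠ gr N \ clF N B) :
    rk N (Y ∪ D) = Y.card + rk N D ∧
      rk N (gr N \ (Y ∪ D)) = ((gr N \ clF N B) \ Y).card + rk N (clF N B \ D) := by
  obtain ⟨y, hy⟩ := hYne
  obtain ⟨x, hxO, hxY⟩ : ∃ x ∈ gr N \ clF N B, x ∉ Y := by
    by_contra h
    push Not at h
    exact hYO (Subset.antisymm hY h)
  have hYx : Y ⊆ (gr N \ clF N B).erase x := fun z hz => mem_erase.2 ⟨fun h => hxY (h ▸ hz), hY hz⟩
  exact ⟨rk_union_eq_of_long_flat hq hcf hB hlong hxO hYx hD,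
    rk_sdiff_union_eq_of_long_flat hq hcf hB hlong hY hy hD⟩

/-- `#O + (q − 2) = ρ(E)` for the complement `O` of a rank-`(q−1)` flat with `ν + q − 2` points. -/
theorem card_sdiff_add_eq_rk' {B : Finset α}
    (hlong : (clF N B).card + rk N (gr N) = (gr N).card + (q - 2)) :
    (gr N \ clF N B).card + (q - 2) = rk N (gr N) := by
  have h4 : (gr N \ clF N B).card = (gr N).card - (clF N B).card := card_sdiff_of_subset (clF_subset_gr B)
  have h5 : (clF N B).card ≤ (gr N).card := card_le_card (clF_subset_gr B)
  omega

/-- **THE DEMANDING SETS AT THE TOP THRESHOLD, CO-RANK `q`**: `A + s · Bℓ` (`2 ≤ q`, `q ≤ ρ(E)`). -/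
theorem card_top_demanding' (hq : 2 ≤ q) (hcf : ∀ z ∈ gr N, rk N ((gr N).erase z) = rk N (gr N))
    {B : Finset α} (hB : B ∈ Rq N (q - 1)) (hlong : (clF N B).card + rk N (gr N) = (gr N).card + (q - 2))
    (hR : q ≤ rk N (gr N)) :
    ((Rq N (q - 1)).filter (fun X => rk N (gr N \ X) = rk N (gr N))).card =
      ((clF N B).powerset.filter
          (fun D => rk N D = q - 1 ∧ rk N ((gr N \ clF N B) ∪ (clF N B \ D)) = rk N (gr N))).card +
        (gr N \ clF N B).card *
          ((clF N B).powerset.filter (fun D => rk N D = q - 2 ∧ rk N (clF N B \ D) = q - 1)).card := by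
  have hs := card_sdiff_add_eq_rk' hlong
  have hclg : clF N B ⊆ gr N := clF_subset_gr B
  have hpow : (gr N).powerset = ((gr N \ clF N B) ∪ clF N B).powerset := by
    rw [sdiff_union_of_subset hclg]
  have hOF : Disjoint (gr N \ clF N B) (clF N B) := sdiff_disjoint
  have hRq : (Rq N (q - 1)).filter (fun X => rk N (gr N \ X) = rk N (gr N)) =
      ((gr N \ clF N B) ∪ clF N B).powerset.filter
        (fun (X : Finset α) => N.eRk (X : Set α) = ((q - 1 : ℕ) : ℕ∞) ∧ rk N (gr N \ X) = rk N (gr N)) := by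
    rw [← hpow]
    unfold Rq
    rw [filter_filter]
  rw [hRq, card_filter_powerset_union_of_disjoint hOF]
  set A := ((clF N B).powerset.filter
    (fun D => rk N D = q - 1 ∧ rk N ((gr N \ clF N B) ∪ (clF N B \ D)) = rk N (gr N))).card with hA
  set Bl := ((clF N B).powerset.filter (fun D => rk N D = q - 2 ∧ rk N (clF N B \ D) = q - 1)).card with hBl
  rw [sum_powerset_eq_sum_choose (fun k => if k = 0 then A else if k = 1 then Bl else 0)]
  · rw [sum_choose_eq_of_zero_from_two _ _ (fun k hk => by
      simp only [show k ≠ 0 by omega, show k ≠ 1 by omega, if_false])]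
    simp only [if_true, show (1 : ℕ) ≠ 0 by norm_num, if_false]
  · intro Y hY
    rw [mem_powerset] at hY
    by_cases hY0 : Y = ∅
    · subst hY0
      simp only [card_empty, if_true]
      rw [hA]
      apply congrArg
      apply filter_congr
      intro D hD
      rw [mem_powerset] at hD
      rw [empty_union, eRk_eq_iff_rk_eq, sdiff_eq_union_sdiff_of_subset_clF B hD]
    by_cases hYO : Y = gr N \ clF N B
    · subst hYO
      have hk : (gr N \ clF N B).card ≠ 0 := by omega
      have hk1 : (gr N \ clF N B).card ≠ 1 := by omega
      simp only [hk, hk1, if_false]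
      rw [card_eq_zero, filter_eq_empty_iff]
      intro D hD
      rw [mem_powerset] at hD
      rintro ⟨_, h2⟩
      rw [sdiff_union_sdiff_eq] at h2
      have := rk_le_of_subset_clF' hB (sdiff_subset : clF N B \ D ⊆ clF N B)
      omega
    · have hYne : Y.Nonempty := nonempty_iff_ne_empty.2 hY0
      have hYcard : Y.card ≠ 0 := by
        rw [Ne, card_eq_zero]; exact hY0
      have hYlt : Y.card < (gr N \ clF N B).card := by
        have := card_le_card hY
        rcases this.lt_or_eq with h | h
        · exact h
        · exact absurd (eq_of_subset_of_card_le hY h.ge) hYO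
      by_cases hk1 : Y.card = 1
      · simp only [hk1, if_true]
        rw [hBl]
        apply congrArg
        apply filter_congr
        intro D hD
        rw [mem_powerset] at hD
        obtain ⟨h1, h2⟩ := rk_union_cases' hq hcf hB hlong hY hD hYne hYO
        rw [eRk_eq_iff_rk_eq, h1, h2, card_sdiff_of_subset hY, hk1]
        have := rk_le_of_subset_clF' hB (sdiff_subset : clF N B \ D ⊆ clF N B)
        constructor
        · rintro ⟨e1, e2⟩; constructor <;> omega
        · rintro ⟨e1, e2⟩; constructor <;> omega
      · simp only [hYcard, hk1, if_false]
        rw [card_eq_zero, filter_eq_empty_iff]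
        intro D hD
        rw [mem_powerset] at hD
        obtain ⟨h1, h2⟩ := rk_union_cases' hq hcf hB hlong hY hD hYne hYO
        rw [eRk_eq_iff_rk_eq, h1, h2, card_sdiff_of_subset hY]
        have := rk_le_of_subset_clF' hB (sdiff_subset : clF N B \ D ⊆ clF N B)
        rintro ⟨e1, e2⟩
        omega

/-- **THE TARGETS AT THE TOP THRESHOLD, CO-RANK `q`**: `s · A₂ + C(s,2) · (Bℓ, or C₂ when s = 2)` (`2 ≤ q`,
`q ≤ ρ(E)`). -/
theorem card_top_targets' (hq : 2 ≤ q) (hcf : ∀ z ∈ gr N, rk N ((gr N).erase z) = rk N (gr N))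
    {B : Finset α} (hB : B ∈ Rq N (q - 1)) (hlong : (clF N B).card + rk N (gr N) = (gr N).card + (q - 2))
    (hR : q ≤ rk N (gr N)) :
    (levelSetCoQ N (rk N (gr N) - 1) q).card =
      (gr N \ clF N B).card *
          ((clF N B).powerset.filter (fun D => rk N D = q - 1 ∧ q - 2 ≤ rk N (clF N B \ D))).card +
        (gr N \ clF N B).card.choose 2 *
          (if (gr N \ clF N B).card = 2 then
            ((clF N B).powerset.filter
              (fun D => rk N ((gr N \ clF N B) ∪ D) = q ∧ rk N (clF N B \ D) = q - 1)).card
          else ((clF N B).powerset.filter (fun D => rk N D = q - 2 ∧ rk N (clF N B \ D) = q - 1)).card) := by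
  have hs := card_sdiff_add_eq_rk' hlong
  have hclg : clF N B ⊆ gr N := clF_subset_gr B
  have hpow : (gr N).powerset = ((gr N \ clF N B) ∪ clF N B).powerset := by
    rw [sdiff_union_of_subset hclg]
  have hOF : Disjoint (gr N \ clF N B) (clF N B) := sdiff_disjoint
  have hT : levelSetCoQ N (rk N (gr N) - 1) q =
      ((gr N \ clF N B) ∪ clF N B).powerset.filter
        (fun (X : Finset α) => N.eRk (X : Set α) = (q : ℕ∞) ∧ rk N (gr N) - 1 ≤ rk N (gr N \ X)) := by
    rw [← hpow]
    ext X
    rw [mem_levelSetCoQ, mem_filter, mem_powerset]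
    tauto
  rw [hT, card_filter_powerset_union_of_disjoint hOF]
  set A2 := ((clF N B).powerset.filter (fun D => rk N D = q - 1 ∧ q - 2 ≤ rk N (clF N B \ D))).card with hA2
  set Bl := ((clF N B).powerset.filter (fun D => rk N D = q - 2 ∧ rk N (clF N B \ D) = q - 1)).card with hBl
  set C2 := ((clF N B).powerset.filter
    (fun D => rk N ((gr N \ clF N B) ∪ D) = q ∧ rk N (clF N B \ D) = q - 1)).card with hC2
  set s := (gr N \ clF N B).card with hsdef
  rw [sum_powerset_eq_sum_choose
    (fun k => if k = 1 then A2 else if k = 2 then (if s = 2 then C2 else Bl) else 0)]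
  · rw [sum_choose_eq_of_zero_from_three s (by omega) _ (fun k hk => by
      simp only [show k ≠ 1 by omega, show k ≠ 2 by omega, if_false])]
    simp only [show (0 : ℕ) ≠ 1 by norm_num, show (0 : ℕ) ≠ 2 by norm_num, if_false, if_true,
      show (2 : ℕ) ≠ 1 by norm_num, zero_add]
  · intro Y hY
    rw [mem_powerset] at hY
    by_cases hY0 : Y = ∅
    · subst hY0
      simp only [card_empty, show (0 : ℕ) ≠ 1 by norm_num, show (0 : ℕ) ≠ 2 by norm_num, if_false]
      rw [card_eq_zero, filter_eq_empty_iff]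
      intro D hD
      rw [mem_powerset] at hD
      rintro ⟨h1, _⟩
      rw [empty_union, eRk_eq_iff_rk_eq] at h1
      have := rk_le_of_subset_clF' hB hD
      omega
    by_cases hYO : Y = gr N \ clF N B
    · subst hYO
      have hk1 : (gr N \ clF N B).card ≠ 1 := by omega
      simp only [hk1, if_false]
      by_cases hs2 : (gr N \ clF N B).card = 2
      · rw [← hsdef] at hs2 ⊢
        simp only [hs2, if_true]
        rw [hC2]
        apply congrArg
        apply filter_congr
        intro D hD
        rw [mem_powerset] at hD
        rw [eRk_eq_iff_rk_eq, sdiff_union_sdiff_eq]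
        have := rk_le_of_subset_clF' hB (sdiff_subset : clF N B \ D ⊆ clF N B)
        constructor
        · rintro ⟨e1, e2⟩; constructor <;> omega
        · rintro ⟨e1, e2⟩; constructor <;> omega
      · rw [← hsdef] at hs2 ⊢
        simp only [hs2, if_false]
        rw [card_eq_zero, filter_eq_empty_iff]
        intro D hD
        rw [mem_powerset] at hD
        rintro ⟨_, h2⟩
        rw [sdiff_union_sdiff_eq] at h2
        have := rk_le_of_subset_clF' hB (sdiff_subset : clF N B \ D ⊆ clF N B)
        omega
    · have hYne : Y.Nonempty := nonempty_iff_ne_empty.2 hY0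
      have hYlt : Y.card < (gr N \ clF N B).card := by
        have := card_le_card hY
        rcases this.lt_or_eq with h | h
        · exact h
        · exact absurd (eq_of_subset_of_card_le hY h.ge) hYO
      obtain ⟨h1, h2⟩ : (∀ D ⊆ clF N B, rk N (Y ∪ D) = Y.card + rk N D) ∧
          (∀ D ⊆ clF N B, rk N (gr N \ (Y ∪ D)) = ((gr N \ clF N B) \ Y).card + rk N (clF N B \ D)) :=
        ⟨fun D hD => (rk_union_cases' hq hcf hB hlong hY hD hYne hYO).1,
         fun D hD => (rk_union_cases' hq hcf hB hlong hY hD hYne hYO).2⟩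
      by_cases hk1 : Y.card = 1
      · simp only [hk1, if_true]
        rw [hA2]
        apply congrArg
        apply filter_congr
        intro D hD
        rw [mem_powerset] at hD
        rw [eRk_eq_iff_rk_eq, h1 D hD, h2 D hD, card_sdiff_of_subset hY, hk1]
        have := rk_le_of_subset_clF' hB (sdiff_subset : clF N B \ D ⊆ clF N B)
        constructor
        · rintro ⟨e1, e2⟩; constructor <;> omega
        · rintro ⟨e1, e2⟩; constructor <;> omega
      by_cases hk2 : Y.card = 2
      · have hs2 : s ≠ 2 := by rw [hsdef]; omega
        simp only [hk2, hs2, if_false, if_true]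
        rw [hBl]
        apply congrArg
        apply filter_congr
        intro D hD
        rw [mem_powerset] at hD
        rw [eRk_eq_iff_rk_eq, h1 D hD, h2 D hD, card_sdiff_of_subset hY, hk2]
        have := rk_le_of_subset_clF' hB (sdiff_subset : clF N B \ D ⊆ clF N B)
        constructor
        · rintro ⟨e1, e2⟩; constructor <;> omega
        · rintro ⟨e1, e2⟩; constructor <;> omega
      · simp only [hk1, hk2, if_false]
        rw [card_eq_zero, filter_eq_empty_iff]
        intro D hD
        rw [mem_powerset] at hD
        rw [eRk_eq_iff_rk_eq, h1 D hD, h2 D hD, card_sdiff_of_subset hY]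
        have := rk_le_of_subset_clF' hB (sdiff_subset : clF N B \ D ⊆ clF N B)
        have hY0' : Y.card ≠ 0 := by rw [Ne, card_eq_zero]; exact hY0
        rintro ⟨e1, e2⟩
        omega

end TopLongFlatCount

end PercRepro.Cogirth
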